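import Summits.FinalStateConjecture.FinalStateConjecture.Theorems.EIHFluxBalanceInertialRecessionRechartCausalKit

/-!
# Route EIHFluxBalance — `InertialRecession`, re-charting: the lab-slab → certified-slab transfer

Helper file for the crux `stmt-FinalStateConjecture-10166`
(`Summit.FinalStateConjecture.FinalStateConjecture.Theses.EIHFluxBalance.InertialRecession`),
stub `stub_rechart` (the transfer P2 of line `sublinear-is-free-clean-window-charges`).

The covering clauses of the re-charted `FinalStateDecomposition` (`diff_subset_causalPast`,
clause (ii) of `HasExhaustiveCharts`) say: every point of the exterior region `O` is either
CERTIFIED-LATE after chart time `τ₁` (in the flat chart's image of `{x⁰ > τ₁}` or in a hole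
chart's image of `{t*ᵢ > τ₁, rᵢ ≤ Rᵢ(t*ᵢ)}`) or lies in the causal past of the CERTIFIED SLAB
(flat image of `{x⁰ = τ₁}` plus the hole charts' images of the truncated tilted slabs
`{t*ᵢ = τ₁, rᵢ ≤ Rᵢ(τ₁)}`). This file derives that statement
(`exterior_subset_certified_union_causalPast`) for an ABSTRACT family of charts from:

* the hypothesis' exhaustion clause toward LAB slabs (every point of `O` not charted after lab
  time `t₁` lies in `J⁻` of the lab slab `t₁` of the painted exterior);
* a splitting of the late painted exterior into the flat domain `U₀` and the near balls
  (painted radius `≤ Rb(x⁰)`) of the holes, with coverage of the balls by the hole charts and the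
  time dictionary `|t*ᵢ − αᵢ x⁰| ≤ βᵢ rᵢ` (`αᵢ = 1/γᵢ`, `βᵢ = ‖Vᵢ‖` for boosted charts);
* the HOVER property of each hole chart (file `…RechartHover`): late points of hole time `≤ τ₁`
  below the certified radius reach the certified tilted slab causally;
* meshing inequalities between the ball radius `Rb`, the certified radii `Rᵢ` (monotone) and the
  dictionary (`Rb(t) ≤ Rᵢ(αᵢt − βᵢRb(t))`; hole time of ball points on the lab slab `t` is `≤ t`);
* transitivity `J⁻ ∘ J⁻ = J⁻` (file `…RechartCausalKit`).

[folklore causal bookkeeping]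
-/

noncomputable section

set_option linter.dupNamespace false

open Set Filter Topology Function TopologicalSpace Literature.Geometry.Lorentzian
open scoped Manifold ContDiff

namespace Summit.FinalStateConjecture.FinalStateConjecture.Theorems

section Transfer

variable {𝓢 : Spacetime 4} {N : ℕ} (U : Opens E4) (Φ : U → 𝓢.carrier) (O : Set 𝓢.carrier)
  (Pext : U → Prop) (rp : Fin N → U → ℝ) (rH : Fin N → ℝ)
  (Kb : Fin N → ModelBackground) (ψ : ∀ i, (Kb i).domain → 𝓢.carrier)
  (R : Fin N → ℝ → ℝ) (hRm : ∀ i, Monotone (R i))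
  (U₀ : Opens E4) (hU₀ : U₀ ≤ U) (Rb : ℝ → ℝ) (α β : Fin N → ℝ) {τ₀ τ₀' Tc S : ℝ}
  (hτ : τ₀ < τ₀') (hTc : Tc ≤ τ₀') (hβ : ∀ i, 0 ≤ β i)
  (hexh : ∀ t₁ : ℝ, τ₀ < t₁ → O \ Φ '' {x : U | t₁ < x.1 0 ∧ Pext x} ⊆
    𝓢.metric.causalPast 𝓢.timeOrientation (Φ '' {x : U | x.1 0 = t₁ ∧ Pext x}))
  (hsplit : ∀ x : U, τ₀' ≤ x.1 0 → Pext x → x.1 ∈ (U₀ : Set E4) ∨ ∃ i, rp i x ≤ Rb (x.1 0))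
  (hPext : ∀ (x : U) (i : Fin N), Pext x → rH i < rp i x)
  (hcov : ∀ (i : Fin N) (x : U), Tc ≤ x.1 0 → rH i < rp i x → rp i x ≤ Rb (x.1 0) →
    ∃ y : (Kb i).domain, ψ i y = Φ x ∧ (Kb i).radius y.1 = rp i x ∧
      |(Kb i).time y.1 - α i * x.1 0| ≤ β i * rp i x)
  (hhover : ∀ (i : Fin N) (y : (Kb i).domain) (τ₁ : ℝ), τ₀' ≤ τ₁ → S ≤ (Kb i).time y.1 →
    (Kb i).time y.1 ≤ τ₁ → (Kb i).radius y.1 ≤ R i ((Kb i).time y.1) →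
      ψ i y ∈ 𝓢.metric.causalPast 𝓢.timeOrientation (ψ i '' (Kb i).truncTimeSlab (R i τ₁) τ₁))
  (hmesh : ∀ (i : Fin N) (t : ℝ), τ₀' ≤ t → S ≤ α i * t - β i * Rb t ∧
    Rb t ≤ R i (α i * t - β i * Rb t) ∧ α i * t + β i * Rb t ≤ t)

include hRm hTc hβ hcov hmesh in
/-- **Dictionary for ball points.** A late ball point of hole `i` (lab time `t ≥ τ₀'`, painted
radius in `(rHᵢ, Rb(t)]`) is `ψᵢ y` for a model point `y` with `S ≤ t*(y) ≤ αᵢt + βᵢRb(t)` and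
`rᵢ(y) ≤ Rᵢ(t*(y))`. [folklore] -/
theorem exists_model_point_of_ball (i : Fin N) (x : U) (hx : τ₀' ≤ x.1 0)
    (hxr : rH i < rp i x) (hxb : rp i x ≤ Rb (x.1 0)) :
    ∃ y : (Kb i).domain, ψ i y = Φ x ∧ S ≤ (Kb i).time y.1 ∧
      (Kb i).time y.1 ≤ α i * x.1 0 + β i * Rb (x.1 0) ∧
      (Kb i).radius y.1 ≤ R i ((Kb i).time y.1) := by
  obtain ⟨y, hyψ, hyr, hyt⟩ := hcov i x (hTc.trans hx) hxr hxb
  obtain ⟨hS, hRb, -⟩ := hmesh i (x.1 0) hx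
  have hβb : β i * rp i x ≤ β i * Rb (x.1 0) := mul_le_mul_of_nonneg_left hxb (hβ i)
  have ht1 : α i * x.1 0 - β i * Rb (x.1 0) ≤ (Kb i).time y.1 := by
    have := (abs_le.mp hyt).1; linarith
  have ht2 : (Kb i).time y.1 ≤ α i * x.1 0 + β i * Rb (x.1 0) := by
    have := (abs_le.mp hyt).2; linarith
  refine ⟨y, hyψ, hS.trans ht1, ht2, ?_⟩
  rw [hyr]
  exact hxb.trans (hRb.trans (hRm i ht1))

include hRm hτ hTc hβ hexh hsplit hPext hcov hhover hmesh in
/-- **The transfer.** Under the hypotheses of this section, for every chart time `τ₁ ≥ τ₀'`,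
every point of `O` is certified-late after `τ₁` or lies in the causal past of the certified slab
at `τ₁` (flat lab slab `{x⁰ = τ₁} ∩ U₀` plus the truncated tilted hole slabs). Proof: exhaustion at
lab time `τ₁` puts the point either in the painted exterior after `τ₁` — flat-late, hole-late, or
(lagging hole time) in `J⁻` of a tilted slab by HOVER — or in `J⁻` of the lab slab `τ₁`, every
point of which is on the flat slab or (ball points have hole time `≤ τ₁`) in `J⁻` of a tilted slab
by HOVER; conclude by `J⁻ ∘ J⁻ = J⁻`. [folklore] -/
theorem exterior_subset_certified_union_causalPast (τ₁ : ℝ) (hτ₁ : τ₀' ≤ τ₁) :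
    O ⊆ ((Φ ∘ Opens.inclusion hU₀) '' {x : U₀ | τ₁ < x.1 0} ∪
        ⋃ i, ψ i '' {y | τ₁ < (Kb i).time y.1 ∧ (Kb i).radius y.1 ≤ R i ((Kb i).time y.1)}) ∪
      𝓢.metric.causalPast 𝓢.timeOrientation
        ((Φ ∘ Opens.inclusion hU₀) '' {x : U₀ | x.1 0 = τ₁} ∪
          ⋃ i, ψ i '' (Kb i).truncTimeSlab (R i τ₁) τ₁) := by
  set certS : Set 𝓢.carrier := (Φ ∘ Opens.inclusion hU₀) '' {x : U₀ | x.1 0 = τ₁} ∪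
    ⋃ i, ψ i '' (Kb i).truncTimeSlab (R i τ₁) τ₁ with hcertS
  have hholeS : ∀ i, ψ i '' (Kb i).truncTimeSlab (R i τ₁) τ₁ ⊆ certS := fun i ↦
    (subset_iUnion (fun i ↦ ψ i '' (Kb i).truncTimeSlab (R i τ₁) τ₁) i).trans subset_union_right
  have hJmono : ∀ i, 𝓢.metric.causalPast 𝓢.timeOrientation
      (ψ i '' (Kb i).truncTimeSlab (R i τ₁) τ₁) ⊆
        𝓢.metric.causalPast 𝓢.timeOrientation certS := fun i ↦
    LorentzianMetric.causalFuture_mono (hholeS i)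
  -- Claim A: the lab slab `τ₁` of the painted exterior lies in `J⁻(certS)`
  have hA : Φ '' {x : U | x.1 0 = τ₁ ∧ Pext x} ⊆
      𝓢.metric.causalPast 𝓢.timeOrientation certS := by
    rintro _ ⟨x, ⟨hx0, hxP⟩, rfl⟩
    have hxτ : τ₀' ≤ x.1 0 := by rw [hx0]; exact hτ₁
    rcases hsplit x hxτ hxP with hU | ⟨i, hi⟩
    · exact LorentzianMetric.subset_causalPast _ _ _ (Or.inl ⟨⟨x.1, hU⟩, hx0, rfl⟩)
    · obtain ⟨y, hyψ, hyS, hyt, hyR⟩ := exists_model_point_of_ball U Φ rp rH Kb ψ R hRm Rb α β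
        hTc hβ hcov hmesh i x hxτ (hPext x i hxP) hi
      obtain ⟨-, -, h3⟩ := hmesh i (x.1 0) hxτ
      have hy₁ : (Kb i).time y.1 ≤ τ₁ := by rw [← hx0]; exact hyt.trans h3
      rw [← hyψ]
      exact hJmono i (hhover i y τ₁ hτ₁ hyS hy₁ hyR)
  -- Claim B: the painted exterior after lab time `τ₁` is certified-late or in `J⁻(certS)`
  have hB : Φ '' {x : U | τ₁ < x.1 0 ∧ Pext x} ⊆
      ((Φ ∘ Opens.inclusion hU₀) '' {x : U₀ | τ₁ < x.1 0} ∪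
        ⋃ i, ψ i '' {y | τ₁ < (Kb i).time y.1 ∧ (Kb i).radius y.1 ≤ R i ((Kb i).time y.1)}) ∪
      𝓢.metric.causalPast 𝓢.timeOrientation certS := by
    rintro _ ⟨x, ⟨hx0, hxP⟩, rfl⟩
    have hxτ : τ₀' ≤ x.1 0 := hτ₁.trans hx0.le
    rcases hsplit x hxτ hxP with hU | ⟨i, hi⟩
    · exact Or.inl (Or.inl ⟨⟨x.1, hU⟩, hx0, rfl⟩)
    · obtain ⟨y, hyψ, hyS, -, hyR⟩ := exists_model_point_of_ball U Φ rp rH Kb ψ R hRm Rb α β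
        hTc hβ hcov hmesh i x hxτ (hPext x i hxP) hi
      rcases lt_or_ge τ₁ ((Kb i).time y.1) with h | h
      · exact Or.inl (Or.inr (mem_iUnion.mpr ⟨i, y, ⟨h, hyR⟩, hyψ⟩))
      · right
        rw [← hyψ]
        exact hJmono i (hhover i y τ₁ hτ₁ hyS h hyR)
  -- exhaustion at lab time `τ₁`, then `J⁻ ∘ J⁻ = J⁻`
  intro p hp
  by_cases hpE : p ∈ Φ '' {x : U | τ₁ < x.1 0 ∧ Pext x}
  · exact hB hpE
  · have hJ := hexh τ₁ (hτ.trans_le hτ₁) ⟨hp, hpE⟩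
    exact Or.inr (mem_causalPast_of_subset_causalPast
      (WithTop.coe_le_coe.mpr le_top : (2 : ℕ∞ω) ≤ ∞) hJ hA)

/-- Registered one-line form (stub `transfer_exterior_subset_certified` of the crux item) of
`exterior_subset_certified_union_causalPast`. [folklore] -/
theorem transfer_exterior_subset_certified : open Literature.Geometry.Lorentzian Set Topology in ∀ {𝓢 : Spacetime 4} {N : ℕ} (U : TopologicalSpace.Opens E4) (Φ : U → 𝓢.carrier) (O : Set 𝓢.carrier) (Pext : U → Prop) (rp : Fin N → U → ℝ) (rH : Fin N → ℝ) (Kb : Fin N → ModelBackground) (ψ : ∀ i, (Kb i).domain → 𝓢.carrier) (R : Fin N → ℝ → ℝ), (∀ i, Monotone (R i)) → ∀ (U₀ : TopologicalSpace.Opens E4) (hU₀ : U₀ ≤ U) (Rb : ℝ → ℝ) (α β : Fin N → ℝ) {τ₀ τ₀' Tc S : ℝ}, τ₀ < τ₀' → Tc ≤ τ₀' → (∀ i, 0 ≤ β i) → (∀ t₁ : ℝ, τ₀ < t₁ → O \ Φ '' {x : U | t₁ < x.1 0 ∧ Pext x} ⊆ 𝓢.metric.causalPast 𝓢.timeOrientation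 (Φ '' {x : U | x.1 0 = t₁ ∧ Pext x})) → (∀ x : U, τ₀' ≤ x.1 0 → Pext x → x.1 ∈ (U₀ : Set E4) ∨ ∃ i, rp i x ≤ Rb (x.1 0)) → (∀ (x : U) (i : Fin N), Pext x → rH i < rp i x) → (∀ (i : Fin N) (x : U), Tc ≤ x.1 0 → rH i < rp i x → rp i x ≤ Rb (x.1 0) → ∃ y : (Kb i).domain, ψ i y = Φ x ∧ (Kb i).radius y.1 = rp i x ∧ |(Kb i).time y.1 - α i * x.1 0| ≤ β i * rp i x) → (∀ (i : Fin N) (y : (Kb i).domain) (τ₁ : ℝ), τ₀' ≤ τ₁ → S ≤ (Kb i).time y.1 → (Kb i).time y.1 ≤ τ₁ → (Kb i).radius y.1 ≤ R i ((Kb i).time y.1) → ψ i y ∈ 𝓢.metric.causalPast 𝓢.timeOrientation (ψ i '' (Kb i).truncTimeSlab (R i τ₁) τ₁)) → (∀ (i : Fin N) (t : ℝ), τ₀' ≤ t → S ≤ α i * t - β i * Rb t ∧ Rb t ≤ R i (α i * t - β i * Rb t) ∧ α i * t + β i * Rb t ≤ t) → ∀ (τ₁ : ℝ), τ₀' ≤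 τ₁ → O ⊆ ((Φ ∘ TopologicalSpace.Opens.inclusion hU₀) '' {x : U₀ | τ₁ < x.1 0} ∪ ⋃ i, ψ i '' {y | τ₁ < (Kb i).time y.1 ∧ (Kb i).radius y.1 ≤ R i ((Kb i).time y.1)}) ∪ 𝓢.metric.causalPast 𝓢.timeOrientation ((Φ ∘ TopologicalSpace.Opens.inclusion hU₀) '' {x : U₀ | x.1 0 = τ₁} ∪ ⋃ i, ψ i '' (Kb i).truncTimeSlab (R i τ₁) τ₁) :=
  fun U Φ O Pext rp rH Kb ψ R hRm U₀ hU₀ Rb α β _ _ _ _ hτ hTc hβ hexh hsplit hPext hcov hhover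
      hmesh τ₁ hτ₁ ↦
    exterior_subset_certified_union_causalPast U Φ O Pext rp rH Kb ψ R hRm U₀ hU₀ Rb α β hτ hTc
      hβ hexh hsplit hPext hcov hhover hmesh τ₁ hτ₁

end Transfer

end Summit.FinalStateConjecture.FinalStateConjecture.Theorems

end
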